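import Summits.CriticalPhenomena.PercolationContinuityZ3.Theorems.PercNearOneGluingNoHeavyLowerTailSahiSwitchFactoredSplit
import Mathlib.Data.Finset.Card
import HarnessLib

/-!
# `NoHeavyLowerTail` (crux stmt-CriticalPhenomena-4575), master-family line P1 (gen 23):
# switch-factored certificates, II — a PRINCIPAL kernel pays COMBINATORIALLY (fibrewise injection `U₁×U₂×U₃ ↪ K×K×Ω`)

Support file (seat `prim-masterthm-p1`, gen 23; `--supports stmt-CriticalPhenomena-4575`).  Pure proof file, standard axioms, no `sorry`.
Memo `run/shared/lean/prim/prim-masterthm/FROM-prim-masterthm-p1-g23-SWITCH-FACTORED-COMB.md` §9.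

In the vocabulary of `…SahiSwitchFactoredSplit` (a 3-petal sunflower system = an `M₃`-monotone labelling `lab` of `Finset (Fin n)`; kernel
`K = cell lab 4`, petals `cell lab i`, members `U_i = cell lab i ∪ cell lab 4`): **if the kernel is PRINCIPAL, `K = {x : t ⊆ x}`, then for every
3-copy fibre `m` the number of triples of `U₁ × U₂ × U₃` in fibre `m` is at most the number of triples of `K × K × Ω` in fibre `m`**
(`tripleCount_members_le_of_principal`).  This is the COMB (tensor–Bernstein, bias-free) form of the kernel branch `Π μ(U_i) ≤ μ(K)²` —
gen 22's ownership theorem (`…SahiSunflowerPrincipalKernel`, measure level) upgraded to a coefficientwise statement: the switch-factored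
certificate of such a system is `ν = 0`.  PROOF (ownership, as an injection): two members of DIFFERENT petal-classes cannot both miss a point
`e ∈ t` (their union lies in `U_i ∩ U_j = K = ↑t`; `mem_or_mem_of_members`), so in a triple `(u₁,u₂,u₃)` every `e ∈ t` has digit `2` or `3`; send
`(u₁,u₂,u₃) ↦ (u₁ ∪ t, u₂ ∪ t, (u₃ ∖ t) ∪ (t ∩ u₁ ∩ u₂ ∩ u₃))`: kernel × kernel × anything, same fibre, and injective because the slot missing a
digit-2 point `e ∈ t` is determined by `e` alone (the same lemma across two triples). [this work]
-/

namespace Summit.CriticalPhenomena.PercolationContinuityZ3.Theorems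

namespace SahiSwitchFactored

open Finset

variable {n : ℕ}

/-- Membership in a cell. [this work] -/
theorem mem_cell {lab : Finset (Fin n) → Fin 5} {c : Fin 5} {x : Finset (Fin n)} : x ∈ cell lab c ↔ lab x = c := by
  simp [cell]

/-- Membership in a member `U_i = C_i ∪ K`. [this work] -/
theorem mem_member {lab : Finset (Fin n) → Fin 5} {i : Fin 5} {x : Finset (Fin n)} :
    x ∈ cell lab i ∪ cell lab 4 ↔ lab x = i ∨ lab x = 4 := by
  simp [cell]

/-- OWNERSHIP: two members of different petal classes cannot both miss a point of the principal generator `t`. [this work] -/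
theorem mem_or_mem_of_members {lab : Finset (Fin n) → Fin 5} (hlab : IsM3Monotone lab) {t : Finset (Fin n)}
    (hK : ∀ x, lab x = 4 ↔ t ⊆ x) {i j : Fin 5} (hi0 : i ≠ 0) (hj0 : j ≠ 0) (hij : i ≠ j)
    {u v : Finset (Fin n)} (hu : lab u = i ∨ lab u = 4) (hv : lab v = j ∨ lab v = 4) {e : Fin n} (he : e ∈ t) :
    e ∈ u ∨ e ∈ v := by
  -- the union is labelled `4`
  have huv : lab (u ∪ v) = 4 := by
    rcases hu with hu | hu
    · rcases hv with hv | hv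
      · have h1 := hlab u (u ∪ v) subset_union_left
        have h2 := hlab v (u ∪ v) subset_union_right
        rw [hu] at h1; rw [hv] at h2
        rcases h1 with h1 | h1 | h1
        · rcases h2 with h2 | h2 | h2
          · exact absurd (h1.trans h2.symm) hij
          · exact absurd h2 hj0
          · exact h2
        · exact absurd h1 hi0
        · exact h1
      · exact (hK _).2 (((hK v).1 hv).trans subset_union_right)
    · exact (hK _).2 (((hK u).1 hu).trans subset_union_left)
  have ht : t ⊆ u ∪ v := (hK _).1 huv
  simpa [mem_union] using ht he

/-- The injection. [this work] -/
def ownershipMap (t : Finset (Fin n)) (q : Finset (Fin n) × (Finset (Fin n) × Finset (Fin n))) :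
    Finset (Fin n) × (Finset (Fin n) × Finset (Fin n)) :=
  (q.1 ∪ t, (q.2.1 ∪ t, (q.2.2 \ t) ∪ (t ∩ q.1 ∩ q.2.1 ∩ q.2.2)))

/-- **A principal kernel pays combinatorially**: fibrewise `#(U₁×U₂×U₃) ≤ #(K×K×Ω)`. [this work] -/
theorem tripleCount_members_le_of_principal (lab : Finset (Fin n) → Fin 5) (hlab : IsM3Monotone lab)
    (t : Finset (Fin n)) (hK : ∀ x, lab x = 4 ↔ t ⊆ x) (m : Fin n → ℕ) :
    tripleCount (cell lab 1 ∪ cell lab 4) (cell lab 2 ∪ cell lab 4) (cell lab 3 ∪ cell lab 4) m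
      ≤ tripleCount (cell lab 4) (cell lab 4) univ m := by
  unfold tripleCount
  refine Finset.card_le_card_of_injOn (ownershipMap t) ?_ ?_
  · -- maps into `K × K × Ω` and preserves the fibre
    intro q hq
    rw [Finset.mem_coe, mem_filter, mem_product, mem_product] at hq
    obtain ⟨⟨h1, h2, h3⟩, hfib⟩ := hq
    rw [mem_member] at h1 h2 h3
    rw [Finset.mem_coe, mem_filter, mem_product, mem_product, mem_cell, mem_cell]
    refine ⟨⟨(hK _).2 subset_union_right, (hK _).2 subset_union_right, mem_univ _⟩, ?_⟩
    funext e
    have hfe := congrFun hfib e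
    simp only [tripleFibre, ownershipMap] at hfe ⊢
    by_cases het : e ∈ t
    · -- every `e ∈ t` is missed by at most one of the three
      have h12 := mem_or_mem_of_members hlab hK (i := 1) (j := 2) (by decide) (by decide) (by decide) h1 h2 het
      have h13 := mem_or_mem_of_members hlab hK (i := 1) (j := 3) (by decide) (by decide) (by decide) h1 h3 het
      have h23 := mem_or_mem_of_members hlab hK (i := 2) (j := 3) (by decide) (by decide) (by decide) h2 h3 het
      rw [← hfe]
      by_cases e1 : e ∈ q.1 <;> by_cases e2 : e ∈ q.2.1 <;> by_cases e3 : e ∈ q.2.2 <;>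
        simp_all [mem_union, mem_sdiff, mem_inter]
    · rw [← hfe]
      simp [mem_union, mem_sdiff, mem_inter, het]
  · -- injective on `U₁ × U₂ × U₃`
    intro q hq q' hq' hqq
    rw [Finset.mem_coe, mem_filter, mem_product, mem_product] at hq hq'
    obtain ⟨⟨h1, h2, h3⟩, _⟩ := hq
    obtain ⟨⟨h1', h2', h3'⟩, _⟩ := hq'
    rw [mem_member] at h1 h2 h3 h1' h2' h3'
    simp only [ownershipMap, Prod.mk.injEq] at hqq
    obtain ⟨hy1, hy2, hz⟩ := hqq
    -- pointwise comparison
    have key : ∀ e, (e ∈ q.1 ↔ e ∈ q'.1) ∧ (e ∈ q.2.1 ↔ e ∈ q'.2.1) ∧ (e ∈ q.2.2 ↔ e ∈ q'.2.2) := by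
      intro e
      have ey1 := congrArg (fun s => e ∈ s) hy1
      have ey2 := congrArg (fun s => e ∈ s) hy2
      have ez := congrArg (fun s => e ∈ s) hz
      simp only [mem_union, mem_sdiff, mem_inter, eq_iff_iff] at ey1 ey2 ez
      by_cases het : e ∈ t
      · -- within each triple at most one slot misses `e`; across the two triples the missing slots coincide
        have a12 := mem_or_mem_of_members hlab hK (i := 1) (j := 2) (by decide) (by decide) (by decide) h1 h2 het
        have a13 := mem_or_mem_of_members hlab hK (i := 1) (j := 3) (by decide) (by decide) (by decide) h1 h3 het
        have a23 := mem_or_mem_of_members hlab hK (i := 2) (j := 3) (by decide) (by decide) (by decide) h2 h3 het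
        have b12 := mem_or_mem_of_members hlab hK (i := 1) (j := 2) (by decide) (by decide) (by decide) h1' h2' het
        have b13 := mem_or_mem_of_members hlab hK (i := 1) (j := 3) (by decide) (by decide) (by decide) h1' h3' het
        have b23 := mem_or_mem_of_members hlab hK (i := 2) (j := 3) (by decide) (by decide) (by decide) h2' h3' het
        -- cross pairs (slot i of q, slot j ≠ i of q')
        have c12 := mem_or_mem_of_members hlab hK (i := 1) (j := 2) (by decide) (by decide) (by decide) h1 h2' het
        have c13 := mem_or_mem_of_members hlab hK (i := 1) (j := 3) (by decide) (by decide) (by decide) h1 h3' het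
        have c21 := mem_or_mem_of_members hlab hK (i := 2) (j := 1) (by decide) (by decide) (by decide) h2 h1' het
        have c23 := mem_or_mem_of_members hlab hK (i := 2) (j := 3) (by decide) (by decide) (by decide) h2 h3' het
        have c31 := mem_or_mem_of_members hlab hK (i := 3) (j := 1) (by decide) (by decide) (by decide) h3 h1' het
        have c32 := mem_or_mem_of_members hlab hK (i := 3) (j := 2) (by decide) (by decide) (by decide) h3 h2' het
        by_cases e1 : e ∈ q.1 <;> by_cases e2 : e ∈ q.2.1 <;> by_cases e3 : e ∈ q.2.2 <;>
          by_cases f1 : e ∈ q'.1 <;> by_cases f2 : e ∈ q'.2.1 <;> by_cases f3 : e ∈ q'.2.2 <;>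
            simp_all
      · simp_all
    ext e <;> simp only [key]

end SahiSwitchFactored

end Summit.CriticalPhenomena.PercolationContinuityZ3.Theorems
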